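import Literature.NumberTheory.Rogawski1990.ArchCentralLimitChamberValueMid     -- (f2) FILE 3b (this seat): `chamberValue_Sminus_of_D`, `chamberValue_of_reflect`; brings ★ (f1), ★ FILE 2, ★ FILE 3a, ★ `perm_fin_three_cases`
import Literature.NumberTheory.Rogawski1990.ArchCentralLimitChamberValueMin     -- ★ p846676 ((f2) FILE 1, this seat): `chamberValue_min_of_core`
import Literature.NumberTheory.Rogawski1990.ArchCentralLimitFormulaOfOppositeSigns -- ★ p844336 (A-p18): `archCentralLimitFormulaRankTwo_of_ppm`
import Literature.NumberTheory.Rogawski1990.ArchCentralLimitFormulaOfExistsLetter -- ★ p846458 (F0P3a-p09): `ArchCentralLimitExists.of_rankTwo`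
import HarnessLib

/-!
# ROAD «A6-IV» brick (f2), FILE 4 — THE LETTER `(L_{U(2,1)})` AND (A6-lim) FROM HARISH-CHANDRA'S CHAMBER JET BOUNDS AND W6-core, THE WHITNEY-FREE ROUTE (jet sockets + per-chamber values)
# (Rogawski 1990 §8.4 pp. 126–127; Warner II Thm. 8.4.3.1 ⟹ §8.5.1; Harish-Chandra [H₂] L. 17.5)

Topic `NumberTheory/Rogawski1990`; namespace `Literature.NumberTheory.Rogawski1990`.  THEOREMS ONLY (no `def`, no instance, no notation, no axiom, no named fact, no `sorry`).
Cell `pub/hodgecm-mathlib`, ENGINE T1 (crux H413 = `stmt-HodgeConjecture-24833`); ROAD A, design of record `DESIGN-A6-InHouse-v2-ArchitectureIV` 93542b84 §2 (f2) (owner∕architect F0P3a-p05 (g15),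
R-15.10 (1) «(f1)(f2) = p02»); pen F0P3a-p02 (g15), 2026-09-01.

THE ASSEMBLY (an INDEPENDENT twin of ★ p846672 `archCentralLimitFormulaRankTwo_of_liePhiJetBounds` (F0P3a-p09 (g2)), which reaches the same conclusion through Whitney's extension theorem ★ and
the extension-form values of ED. 4∕5; THIS file never extends `F_Θ∘chart` beyond a chamber).  At a CM frame `(+,+,−)`: ★ (f1) `ArchCentralLimitFormulaRankTwo.of_liePhiJetBounds_of_values`
wants (d2)'s chamber jet bounds `hball` and the VALUE CLAUSE on all six chambers; the value clause is: ★ FILE 1 `chamberValue_min_of_core` (θ₂-minimal pair, from W6-core's `hcore`) →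
★ FILE 2 `chamberValue_max_of_min` (θ₂-maximal pair) → FILE 3b `chamberValue_Sminus_of_D` (`S⁻ = [1,2,0]` from `D = [1,0,2]`, with the (f1) jet data of both chambers fed by `hball` through
★ `letterJetBound_of_liePhiJetBounds`) → FILE 3b `chamberValue_of_reflect` (`S⁺ = [0,2,1] ↦ S⁻` for `Θ^∨, ζ⁻¹`); the six cases by ★ `perm_fin_three_cases`.
HEADS: **`ArchCentralLimitFormulaRankTwo.of_liePhiJetBounds_of_core`** (CM frame `(+,+,−)`), **`archCentralLimitFormulaRankTwo_of_liePhiJetBounds_of_core`** (every frame, ★ `…_of_ppm`),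
**`archCentralLimitExists_of_liePhiJetBounds_of_core`** ((A6-lim) ★ `ArchCentralLimitExists` at every frame = the type of the closer's `stub_A6lim`).  With ★ p846680 `liePhi_chamberJetBounds` as `hball`
and ★ `ballCore_of_rayIdentity rayIdentity_of_total`-fed `hcore` these are closed terms.
HONEST LABEL: HC_CM is proved only modulo the printed citations until rung 0 closes; plumbing over ★ bricks.

## References
* [Rogawski1990] J. D. Rogawski, *Automorphic Representations of Unitary Groups in Three Variables*, Ann. of Math. Stud. 123 (1990), §8.4 pp. 126–127.
* [WarnerHASSLG2] G. Warner, *Harmonic Analysis on Semi-Simple Lie Groups II* (1972), Thm. 8.4.3.1, §8.5.1.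
* [HarishChandra1975HARRG1] Harish-Chandra, *Harmonic analysis on real reductive groups I*, J. Funct. Anal. 19 (1975), §17 Lemma 17.5.
-/

set_option autoImplicit false

noncomputable section

open Filter Topology Set Function Metric Complex MeasureTheory Measure NumberField NumberField.InfinitePlace Matrix
open scoped ContDiff NNReal Matrix MatrixGroups Matrix.Norms.Operator
open Literature.Analysis.Calculus
open Literature.NumberTheory.Automorphic Literature.NumberTheory.Automorphic.UnitaryGroup
open Literature.Geometry.ComplexHyperbolic Literature.Geometry.ComplexHyperbolic.BallModel

namespace Literature.NumberTheory.Rogawski1990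

section CM

variable (L : Type) [Field L] [NumberField L] [IsCMField L] (α : Fin 3 → L) (w : {w : InfinitePlace L // IsComplex w})

/-- Chamber bookkeeping: `[1,2,0]` written through a permutation `σ` with `σ 0 = 1`, `σ 1 = 2`, `σ 2 = 0`. [cite: Rogawski1990, §8.4 p. 126] -/
theorem chamber_eq_of_apply_eq (σ : Equiv.Perm (Fin 3)) {a b c : Fin 3} (h0 : σ 0 = a) (h1 : σ 1 = b) (h2 : σ 2 = c) :
    {θ : Fin 3 → ℝ | θ (σ 0) < θ (σ 1) ∧ θ (σ 1) < θ (σ 2)} = {θ : Fin 3 → ℝ | θ a < θ b ∧ θ b < θ c} := by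
  rw [h0, h1, h2]

/-- **THE (L_{U(2,1)}) LETTER AT A CM FRAME `(+,+,−)` FROM THE CHAMBER JET BOUNDS AND W6-core — the Whitney-free route.** [cite: Rogawski1990, §8.4 pp. 126–127]
[cite: WarnerHASSLG2, Thm. 8.4.3.1, §8.5.1 Thm. 8.5.1.1] [cite: HarishChandra1975HARRG1, §17 Lemma 17.5] -/
theorem ArchCentralLimitFormulaRankTwo.of_liePhiJetBounds_of_core
    (h0 : 0 < (w.1.embedding (α 0)).re) (h1 : 0 < (w.1.embedding (α 1)).re) (h2 : (w.1.embedding (α 2)).re < 0)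
    (hball : ∀ (μ : Measure U21) [μ.IsHaarMeasure] [μ.IsMulRightInvariant] (f : Matrix (Fin 3) (Fin 3) ℂ → ℂ), ContDiff ℝ ∞ f → HasCompactSupport f →
      ∀ (σ : Equiv.Perm (Fin 3)) (n : ℕ), ∃ M : ℝ, ∀ θ ∈ {θ : Fin 3 → ℝ | θ (σ 0) < θ (σ 1) ∧ θ (σ 1) < θ (σ 2)} ∩ ball (0 : Fin 3 → ℝ) (1 / 4), ‖iteratedFDeriv ℝ n (liePhi μ f) θ‖ ≤ M)
        (hcore : ∀ (μ : Measure BallModel.U21) [μ.IsHaarMeasure],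
      ∃ c : ℝ, 0 < c ∧ ∀ (Θ : Matrix (Fin 3) (Fin 3) ℂ → ℂ), ContDiff ℝ (⊤ : ℕ∞) Θ → HasCompactSupport Θ →
        (∀ κ : Matrix (Fin 3) (Fin 3) ℂ, κ * κᴴ = 1 → κ * BallModel.J = BallModel.J * κ → ∀ X, Θ (κ * X * κᴴ) = Θ X) →
        ∀ ζ : Circle, ∃ (δ : ℝ) (ψ χ : ℝ → ℂ), 0 < δ ∧ δ ≤ 2 ∧ ContDiffOn ℝ 2 ψ (Icc 0 δ) ∧ ContDiffOn ℝ 2 χ (Icc 0 δ) ∧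
          (∀ t ∈ Ioo 0 δ, (2 - 2 * Real.cos (3 * t)) • (∫ g, Θ (BallModel.mat (g * BallModel.mkU21 (Matrix.diagonal ![((ζ * Circle.exp t : Circle) : ℂ), ((ζ * Circle.exp t : Circle) : ℂ), ((ζ * Circle.exp (-2 * t) : Circle) : ℂ)]) (BallModel.diagonal_uuv_preserves (ζ * Circle.exp t) (ζ * Circle.exp (-2 * t))) * g⁻¹)) ∂μ) = ψ t) ∧
          (∀ t ∈ Ioo 0 δ, ‖((ζ * Circle.exp (-2 * t) : Circle) : ℂ) - ((ζ * Circle.exp t : Circle) : ℂ)‖ ^ 4 •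
            iteratedDeriv 2 (fun y : ℝ => ∫ u : BallModel.U21, Θ (BallModel.mat u * Matrix.diagonal (fun k : Fin 3 => (((![ζ * Circle.exp t, ζ * Circle.exp t, ζ * Circle.exp (-2 * t)] : Fin 3 → Circle) k * Circle.exp (y * ((if k = (0 : Fin 3) then (1 : ℝ) else 0) - (if k = (1 : Fin 3) then (1 : ℝ) else 0))) : Circle) : ℂ)) * BallModel.mat u⁻¹) ∂μ) 0 = χ t) ∧
          -(2 / 3) * Complex.I * iteratedDerivWithin 2 ψ (Icc 0 δ) 0 - (1 / 2) * Complex.I * ψ 0 + (1 / 12) * Complex.I * iteratedDerivWithin 2 χ (Icc 0 δ) 0 =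
            -((c : ℂ) * Complex.I) * Θ ((ζ : ℂ) • (1 : Matrix (Fin 3) (Fin 3) ℂ))) :
    ArchCentralLimitFormulaRankTwo L α w := by
  refine ArchCentralLimitFormulaRankTwo.of_liePhiJetBounds_of_values L α w h0 h1 h2 hball ?_
  intro _ _ hα hreal ν _ _
  have hsgn : (w.1.embedding (α 0)).re * (w.1.embedding (α 2)).re < 0 := mul_neg_of_pos_of_neg h0 h2
  -- the value on the four compact-adjacent chambers (★ FILE 1 + ★ FILE 2): ONE constant `c`
  obtain ⟨c, hc, hD⟩ := chamberValue_max_of_min (chamberValue_min_of_core L α w h0 h1 h2 hcore) hα hreal ν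
  refine ⟨c, hc, fun Θ hΘ hΘc ζ σ J hJ => ?_⟩
  -- the value on `S⁻ = [1,2,0]` for EVERY `Θ′, ζ′` (FILE 3b over the (f1) jet data of `S⁻` and `D = [1,0,2]` and the `D` value)
  have hSminus : ∀ (Θ' : Matrix (Fin 3) (Fin 3) ℂ → ℂ), ContDiff ℝ (⊤ : ℕ∞) Θ' →
      HasCompactSupport (fun k : archLocal L 3 (Matrix.diagonal α) w => Θ' ((k : GL (Fin 3) ℂ) : Matrix (Fin 3) (Fin 3) ℂ)) →
      ∀ (ζ' : Circle) (J' : ContinuousMultilinearMap ℝ (fun _ : Fin 3 => Fin 3 → ℝ) ℂ),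
        Tendsto (iteratedFDeriv ℝ 3 (fun θ : Fin 3 → ℝ => ((((ζ' * Circle.exp (θ 0) : Circle) : ℂ)) * (((ζ' * Circle.exp (θ 2) : Circle) : ℂ))⁻¹) * ((1 - (((ζ' * Circle.exp (θ 1) : Circle) : ℂ)) * (((ζ' * Circle.exp (θ 0) : Circle) : ℂ))⁻¹) * (1 - (((ζ' * Circle.exp (θ 2) : Circle) : ℂ)) * (((ζ' * Circle.exp (θ 1) : Circle) : ℂ))⁻¹) * (1 - (((ζ' * Circle.exp (θ 2) : Circle) : ℂ)) * (((ζ' * Circle.exp (θ 0) : Circle) : ℂ))⁻¹)) * (∫ g, Θ' (((g * ⟨circleDiagonal 3 (fun k => ζ' * Circle.exp (θ k)), circleDiagonal_mem_archLocal_diagonal L 3 α w _⟩ * g⁻¹ : archLocal L 3 (Matrix.diagonal α) w) : GL (Fin 3) ℂ) : Matrix (Fin 3) (Fin 3) ℂ) ∂ν))) (𝓝[{θ : Fin 3 → ℝ | θ 1 < θ 2 ∧ θ 2 < θ 0}] 0) (𝓝 J') →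
          (1 / 48 : ℂ) * ∑ ε : Fin 3 → Bool, ((((if ε 0 then (1 : ℝ) else -1) * (if ε 1 then (1 : ℝ) else -1) * (if ε 2 then (1 : ℝ) else -1) : ℝ)) : ℂ) * J' (fun _ : Fin 3 => ![(if ε 0 then (1 : ℝ) else -1) + (if ε 1 then (1 : ℝ) else -1), -(if ε 0 then (1 : ℝ) else -1) + (if ε 2 then (1 : ℝ) else -1), -(if ε 1 then (1 : ℝ) else -1) - (if ε 2 then (1 : ℝ) else -1)]) = -((c : ℂ) * Complex.I) * Θ' ((circleDiagonal 3 (fun _ => ζ') : GL (Fin 3) ℂ) : Matrix (Fin 3) (Fin 3) ℂ) := by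
    intro Θ' hΘ' hΘ'c ζ' J' hJ'
    have eS := chamber_eq_of_apply_eq (Equiv.swap (0 : Fin 3) 1 * Equiv.swap (1 : Fin 3) 2) (a := 1) (b := 2) (c := 0) (by decide) (by decide) (by decide)
    have eD := chamber_eq_of_apply_eq (Equiv.swap (0 : Fin 3) 1) (a := 1) (b := 0) (c := 2) (by decide) (by decide) (by decide)
    obtain ⟨rS, MS, hrS, hFS, hMS⟩ := letterJetBound_of_liePhiJetBounds L α w hα hreal h0 h1 h2 ν Θ' hΘ' hΘ'c ζ' (Equiv.swap (0 : Fin 3) 1 * Equiv.swap (1 : Fin 3) 2)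
      (fun μ _ _ f hf hfc n => hball μ f hf hfc _ n)
    obtain ⟨rD, MD, hrD, hFD, hMD⟩ := letterJetBound_of_liePhiJetBounds L α w hα hreal h0 h1 h2 ν Θ' hΘ' hΘ'c ζ' (Equiv.swap (0 : Fin 3) 1)
      (fun μ _ _ f hf hfc n => hball μ f hf hfc _ n)
    rw [eS] at hFS hMS
    rw [eD] at hFD hMD
    refine chamberValue_Sminus_of_D L α w hα hreal hsgn ν Θ' hΘ' hΘ'c ζ' hrS hFS hMS hrD hFD hMD (fun J'' hJ'' => ?_) J' hJ'
    have h := hD Θ' hΘ' hΘ'c ζ' (Equiv.swap (0 : Fin 3) 1) (Or.inr (by decide)) J''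
    rw [eD] at h
    exact h hJ''
  -- the six chambers
  rcases perm_fin_three_cases σ with hσ | hσ | ⟨hσ0, hσ1, hσ2⟩ | ⟨hσ0, hσ1, hσ2⟩
  · exact hD Θ hΘ hΘc ζ σ (Or.inl hσ) J hJ
  · exact hD Θ hΘ hΘc ζ σ (Or.inr hσ) J hJ
  · rw [chamber_eq_of_apply_eq σ hσ0 hσ1 hσ2] at hJ
    exact hSminus Θ hΘ hΘc ζ J hJ
  · refine chamberValue_of_reflect L α w hα ν c σ (fun Θ' hΘ' hΘ'c ζ' J' hJ' => ?_) Θ hΘ hΘc ζ J hJ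
    have e : {θ : Fin 3 → ℝ | θ ((σ * Equiv.swap (0 : Fin 3) 2) 0) < θ ((σ * Equiv.swap (0 : Fin 3) 2) 1) ∧ θ ((σ * Equiv.swap (0 : Fin 3) 2) 1) < θ ((σ * Equiv.swap (0 : Fin 3) 2) 2)} = {θ : Fin 3 → ℝ | θ 1 < θ 2 ∧ θ 2 < θ 0} := by
      refine chamber_eq_of_apply_eq (σ * Equiv.swap (0 : Fin 3) 2) ?_ ?_ ?_
      · rw [Equiv.Perm.mul_apply, Equiv.swap_apply_left, hσ2]
      · rw [Equiv.Perm.mul_apply, Equiv.swap_apply_of_ne_of_ne (by decide) (by decide), hσ1]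
      · rw [Equiv.Perm.mul_apply, Equiv.swap_apply_right, hσ0]
    rw [e] at hJ'
    exact hSminus Θ' hΘ' hΘ'c ζ' J' hJ'

end CM

section AllFrames

/-- **THE (L_{U(2,1)}) LETTER AT EVERY FRAME from the chamber jet bounds `hball` and W6-core's `hcore`** (★ `archCentralLimitFormulaRankTwo_of_ppm` reduces every frame to the CM pattern
`(+,+,−)`).  An independent, Whitney-free twin of ★ `archCentralLimitFormulaRankTwo_of_liePhiJetBounds` (p846672). [cite: Rogawski1990, §8.4 pp. 126–127] [cite: WarnerHASSLG2, Thm. 8.4.3.1] -/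
theorem archCentralLimitFormulaRankTwo_of_liePhiJetBounds_of_core
    (hball : ∀ (μ : Measure U21) [μ.IsHaarMeasure] [μ.IsMulRightInvariant] (f : Matrix (Fin 3) (Fin 3) ℂ → ℂ), ContDiff ℝ ∞ f → HasCompactSupport f →
      ∀ (σ : Equiv.Perm (Fin 3)) (n : ℕ), ∃ M : ℝ, ∀ θ ∈ {θ : Fin 3 → ℝ | θ (σ 0) < θ (σ 1) ∧ θ (σ 1) < θ (σ 2)} ∩ ball (0 : Fin 3 → ℝ) (1 / 4), ‖iteratedFDeriv ℝ n (liePhi μ f) θ‖ ≤ M)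
        (hcore : ∀ (μ : Measure BallModel.U21) [μ.IsHaarMeasure],
      ∃ c : ℝ, 0 < c ∧ ∀ (Θ : Matrix (Fin 3) (Fin 3) ℂ → ℂ), ContDiff ℝ (⊤ : ℕ∞) Θ → HasCompactSupport Θ →
        (∀ κ : Matrix (Fin 3) (Fin 3) ℂ, κ * κᴴ = 1 → κ * BallModel.J = BallModel.J * κ → ∀ X, Θ (κ * X * κᴴ) = Θ X) →
        ∀ ζ : Circle, ∃ (δ : ℝ) (ψ χ : ℝ → ℂ), 0 < δ ∧ δ ≤ 2 ∧ ContDiffOn ℝ 2 ψ (Icc 0 δ) ∧ ContDiffOn ℝ 2 χ (Icc 0 δ) ∧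
          (∀ t ∈ Ioo 0 δ, (2 - 2 * Real.cos (3 * t)) • (∫ g, Θ (BallModel.mat (g * BallModel.mkU21 (Matrix.diagonal ![((ζ * Circle.exp t : Circle) : ℂ), ((ζ * Circle.exp t : Circle) : ℂ), ((ζ * Circle.exp (-2 * t) : Circle) : ℂ)]) (BallModel.diagonal_uuv_preserves (ζ * Circle.exp t) (ζ * Circle.exp (-2 * t))) * g⁻¹)) ∂μ) = ψ t) ∧
          (∀ t ∈ Ioo 0 δ, ‖((ζ * Circle.exp (-2 * t) : Circle) : ℂ) - ((ζ * Circle.exp t : Circle) : ℂ)‖ ^ 4 •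
            iteratedDeriv 2 (fun y : ℝ => ∫ u : BallModel.U21, Θ (BallModel.mat u * Matrix.diagonal (fun k : Fin 3 => (((![ζ * Circle.exp t, ζ * Circle.exp t, ζ * Circle.exp (-2 * t)] : Fin 3 → Circle) k * Circle.exp (y * ((if k = (0 : Fin 3) then (1 : ℝ) else 0) - (if k = (1 : Fin 3) then (1 : ℝ) else 0))) : Circle) : ℂ)) * BallModel.mat u⁻¹) ∂μ) 0 = χ t) ∧
          -(2 / 3) * Complex.I * iteratedDerivWithin 2 ψ (Icc 0 δ) 0 - (1 / 2) * Complex.I * ψ 0 + (1 / 12) * Complex.I * iteratedDerivWithin 2 χ (Icc 0 δ) 0 =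
            -((c : ℂ) * Complex.I) * Θ ((ζ : ℂ) • (1 : Matrix (Fin 3) (Fin 3) ℂ))) :
    ∀ (L : Type) [Field L] (α : Fin 3 → L) (w : {w : InfinitePlace L // IsComplex w}), ArchCentralLimitFormulaRankTwo L α w :=
  archCentralLimitFormulaRankTwo_of_ppm fun L₀ _ _ _ α₀ w₀ h0 h1 h2 =>
    ArchCentralLimitFormulaRankTwo.of_liePhiJetBounds_of_core L₀ α₀ w₀ h0 h1 h2 hball hcore

/-- **(A6-lim) `ArchCentralLimitExists` AT EVERY FRAME** (the type of the closer's `stub_A6lim`) from `hball` + `hcore`, Whitney-free. [cite: Rogawski1990, §8.4 p. 126 L13]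
[cite: HarishChandra1975HARRG1, §17 Lemma 17.5] -/
theorem archCentralLimitExists_of_liePhiJetBounds_of_core
    (hball : ∀ (μ : Measure U21) [μ.IsHaarMeasure] [μ.IsMulRightInvariant] (f : Matrix (Fin 3) (Fin 3) ℂ → ℂ), ContDiff ℝ ∞ f → HasCompactSupport f →
      ∀ (σ : Equiv.Perm (Fin 3)) (n : ℕ), ∃ M : ℝ, ∀ θ ∈ {θ : Fin 3 → ℝ | θ (σ 0) < θ (σ 1) ∧ θ (σ 1) < θ (σ 2)} ∩ ball (0 : Fin 3 → ℝ) (1 / 4), ‖iteratedFDeriv ℝ n (liePhi μ f) θ‖ ≤ M)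
        (hcore : ∀ (μ : Measure BallModel.U21) [μ.IsHaarMeasure],
      ∃ c : ℝ, 0 < c ∧ ∀ (Θ : Matrix (Fin 3) (Fin 3) ℂ → ℂ), ContDiff ℝ (⊤ : ℕ∞) Θ → HasCompactSupport Θ →
        (∀ κ : Matrix (Fin 3) (Fin 3) ℂ, κ * κᴴ = 1 → κ * BallModel.J = BallModel.J * κ → ∀ X, Θ (κ * X * κᴴ) = Θ X) →
        ∀ ζ : Circle, ∃ (δ : ℝ) (ψ χ : ℝ → ℂ), 0 < δ ∧ δ ≤ 2 ∧ ContDiffOn ℝ 2 ψ (Icc 0 δ) ∧ ContDiffOn ℝ 2 χ (Icc 0 δ) ∧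
          (∀ t ∈ Ioo 0 δ, (2 - 2 * Real.cos (3 * t)) • (∫ g, Θ (BallModel.mat (g * BallModel.mkU21 (Matrix.diagonal ![((ζ * Circle.exp t : Circle) : ℂ), ((ζ * Circle.exp t : Circle) : ℂ), ((ζ * Circle.exp (-2 * t) : Circle) : ℂ)]) (BallModel.diagonal_uuv_preserves (ζ * Circle.exp t) (ζ * Circle.exp (-2 * t))) * g⁻¹)) ∂μ) = ψ t) ∧
          (∀ t ∈ Ioo 0 δ, ‖((ζ * Circle.exp (-2 * t) : Circle) : ℂ) - ((ζ * Circle.exp t : Circle) : ℂ)‖ ^ 4 •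
            iteratedDeriv 2 (fun y : ℝ => ∫ u : BallModel.U21, Θ (BallModel.mat u * Matrix.diagonal (fun k : Fin 3 => (((![ζ * Circle.exp t, ζ * Circle.exp t, ζ * Circle.exp (-2 * t)] : Fin 3 → Circle) k * Circle.exp (y * ((if k = (0 : Fin 3) then (1 : ℝ) else 0) - (if k = (1 : Fin 3) then (1 : ℝ) else 0))) : Circle) : ℂ)) * BallModel.mat u⁻¹) ∂μ) 0 = χ t) ∧
          -(2 / 3) * Complex.I * iteratedDerivWithin 2 ψ (Icc 0 δ) 0 - (1 / 2) * Complex.I * ψ 0 + (1 / 12) * Complex.I * iteratedDerivWithin 2 χ (Icc 0 δ) 0 =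
            -((c : ℂ) * Complex.I) * Θ ((ζ : ℂ) • (1 : Matrix (Fin 3) (Fin 3) ℂ))) :
    ∀ (L : Type) [Field L] (α : Fin 3 → L) (w : {w : InfinitePlace L // IsComplex w}), ArchCentralLimitExists L α w :=
  fun L _ α w => ArchCentralLimitExists.of_rankTwo (archCentralLimitFormulaRankTwo_of_liePhiJetBounds_of_core hball hcore L α w)

end AllFrames

end Literature.NumberTheory.Rogawski1990

end
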